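import Literature.Computability.Cryptography.NaorReingoldEnds
import Literature.Barriers.PneNP.NaturalProofsTC0
import HarnessLib

/-!
# The hashed Naor–Reingold family keyed by bit strings, and the size of its group

Towards `HardPRFInTC0OfSubexpDDH` (`Literature/Barriers/PneNP/NaturalProofsTC0DDH.lean`): the
concrete keyed family of Boolean functions fed to the natural-proofs barrier
(`Literature.Barriers.PneNP.HardPRFInTC0 = ∃ key F, FamilyIn TC0 F ∧ SuperExpHard F`), built from
an instance sequence `⟨P_m, Q_m, g_m⟩` of the DDH assumption and a growth exponent `k`
(`Seq`): at input length `n` the security parameter is `m = n^k` (the Razborov–Rudich coupling,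
Arora–Barak 2009, §23.3: "`n = m^{ε/2}`"), the key is `n + 1` blocks of `2m` uniform bits (the
exponents `a₀, …, aₙ`, NR Construction 4.1, read as numbers; only their residues mod `Q` matter)
followed by `m` bits (the inner-product hash key `r`, NR Construction 4.2), and

  `family σ n s x = ⟨r, bin((g^{a₀})^{∏_{xᵢ=1} aᵢ} mod P)⟩ mod 2`

whenever `⟨P_m, Q_m, g_m⟩` is a DDH instance (and `0` otherwise, so that the family is defined at
every length). This file records:

* `Seq.parse` (the seed as `(K, r)`), `Seq.family`, `Seq.pp` (the level parameters, with `Q`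
  replaced by `max Q 1 = Q` to have `ℤ_Q` nonempty at junk lengths), `tableGen_family` (its truth
  tables are the `seedTable`s of `NaorReingoldEnds.lean`), `prgAdvantage_eq_abs_sub_uProb`;
* `two_rpow_lt_two_mul_Q` — **the group is large under the hardness hypothesis**: the
  `(m+1)`-gate `B₂`-circuit testing "`z = 1`" has DDH advantage `(Q-1)/Q² ≥ 1/(2Q)` (on
  Diffie–Hellman triples `g^{ab} = 1` iff `a = 0 ∨ b = 0`), so `2^{m^δ}`-hardness forces
  `2Q > 2^{m^δ}` (the quantitative form of NR's remark that `Q` must be large, §3.2 p. 242);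
* `entryCost_le` — the simulator's per-entry gate count is `≤ 47 (m+2)⁴`.

## References

* M. Naor, O. Reingold, J. ACM 51 (2004), §3.2 (p. 242), Constructions 4.1–4.2 (pp. 245–246).
* A. Razborov, S. Rudich, *Natural proofs*, JCSS 55 (1997), §4.
* S. Arora, B. Barak, *Computational Complexity: A Modern Approach*, CUP 2009, §23.3.
-/

noncomputable section

namespace Literature.Computability.Cryptography

open Finset Literature.Computability.MetaComplexity Literature.Computability.Complexity
  Literature.Computability.AlgebraicComplexity Literature.Barriers.PneNP

namespace NaorReingold

/-- An instance sequence `m ↦ ⟨P_m, Q_m, g_m⟩` together with the growth exponent `k` of the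
security parameter `m = n^k` in the input length `n`. [cite: NaorReingold2004, §3.2 (p. 242: "a single possible choice of P, Q and g" per security parameter)] -/
structure Seq where
  /-- the moduli -/
  P : ℕ → ℕ
  /-- the orders -/
  Q : ℕ → ℕ
  /-- the bases -/
  g : ℕ → ℕ
  /-- growth exponent: security parameter `m = n ^ k` at input length `n` -/
  k : ℕ

namespace Seq

variable (σ : Seq)

/-- The security parameter at input length `n`: `m = n^k`. [cite: AroraBarakCC2009, §23.3] -/
def m (n : ℕ) : ℕ := n ^ σ.k

/-- Bits per key exponent: `L = 2m` (so that reduction mod `Q < 2^m` is `2^{-m}`-close to uniform). [folklore] -/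
def L (n : ℕ) : ℕ := 2 * σ.m n

/-- Key length at input length `n`: `(n+1) · 2m + m` bits. [cite: NaorReingold2004, Constructions 4.1–4.2 (pp. 245–246)] -/
def keyLen (n : ℕ) : ℕ := (n + 1) * σ.L n + σ.m n

/-- The level parameters at input length `n` (with `Q` replaced by `max Q 1`, equal to `Q` at every
genuine instance, so that `ℤ_Q` is nonempty at all lengths). [folklore] -/
def pp (n : ℕ) : Params where
  n := n
  m := σ.m n
  P := σ.P (σ.m n)
  Q := max (σ.Q (σ.m n)) 1
  g := σ.g (σ.m n)
  Q_pos := lt_max_of_lt_right Nat.one_pos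

/-- **Parsing the seed**: `(n+1) · 2m + m` bits are `n + 1` numbers `K_i < 2^{2m}` and an `m`-bit
hash key. [folklore] -/
def parse (n : ℕ) : (Fin (σ.keyLen n) → Bool) ≃ (Fin (n + 1) → Fin (2 ^ σ.L n)) × (Fin (σ.m n) → Bool) :=
  ((finSumFinEquiv (m := (n + 1) * σ.L n) (n := σ.m n)).symm.arrowCongr (Equiv.refl Bool)).trans <|
    (Equiv.sumArrowEquivProdArrow _ _ Bool).trans <|
      Equiv.prodCongr
        ((finProdFinEquiv.symm.arrowCongr (Equiv.refl Bool)).trans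
          ((Equiv.curry _ _ _).trans (Equiv.arrowCongr (Equiv.refl _) (boolFunEquivFin (σ.L n)))))
        (Equiv.refl _)

/-- `⟨P_m, Q_m, g_m⟩` is a DDH instance at the security parameter of length `n`. [cite: NaorReingold2004, §3.2 (p. 242)] -/
def IsInst (n : ℕ) : Prop := IsDDHInstance (σ.m n) (σ.P (σ.m n)) (σ.Q (σ.m n)) (σ.g (σ.m n))

open Classical in
/-- **The keyed family**: at a genuine instance, the inner-product hash of the Naor–Reingold
value `(g^{K₀})^{∏_{xᵢ=1} K_{i+1}} mod P` with the parsed key; `0` at junk lengths. [cite: NaorReingold2004, Constructions 4.1–4.2 (pp. 245–246)] -/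
def family (n : ℕ) (s : Fin (σ.keyLen n) → Bool) (x : Fin n → Bool) : Bool :=
  if σ.IsInst n then
    (σ.pp n).hashBit (σ.parse n s).2 (nrFun (σ.P (σ.m n)) (σ.g (σ.m n)) (fun i => ((σ.parse n s).1 i).val) x)
  else false

variable {σ}

/-- At a genuine instance the truth table of a member is the `seedTable` of the parsed key. [folklore] -/
theorem tableGen_family {n : ℕ} (h : σ.IsInst n) (s : Fin (σ.keyLen n) → Bool) :
    tableGen σ.family n s = (σ.pp n).seedTable (σ.L n) (σ.parse n s).1 (σ.parse n s).2 := by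
  funext t
  simp only [tableGen, family, if_pos h]
  rfl

/-- At a junk length every member is the zero function. [folklore] -/
theorem family_of_not_isInst {n : ℕ} (h : ¬ σ.IsInst n) : σ.family n = fun _ _ => false := by
  funext s x
  simp only [family, if_neg h]

/-- The tree's `prgAdvantage` in terms of `uProb`. [cite: RazborovRudich1997, §4] -/
theorem prgAdvantage_eq_abs_sub_uProb {K M : ℕ} (T : Circuit (Fin M)) (G : (Fin K → Bool) → (Fin M → Bool)) :
    prgAdvantage T G = |uProb (fun s : Fin K → Bool => T.eval (G s)) - uProb (fun y : Fin M → Bool => T.eval y)| := by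
  unfold prgAdvantage uProb
  simp [Fintype.card_bool, Fintype.card_fin]

/-- The distinguishing advantage against the family at a genuine instance is the advantage against
the parsed seed tables. [folklore] -/
theorem prgAdvantage_tableGen_family {n : ℕ} (h : σ.IsInst n) (T : Circuit (Fin (2 ^ n))) :
    prgAdvantage T (tableGen σ.family n) =
      |uProb (fun ω : (Fin (n + 1) → Fin (2 ^ σ.L n)) × (Fin (σ.m n) → Bool) =>
          T.eval ((σ.pp n).seedTable (σ.L n) ω.1 ω.2)) - uProb (fun y : Fin (2 ^ n) → Bool => T.eval y)| := by
  rw [prgAdvantage_eq_abs_sub_uProb]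
  simp only [tableGen_family h]
  rw [← uProb_comp_equiv (σ.parse n).symm (fun s : Fin (σ.keyLen n) → Bool =>
    T.eval ((σ.pp n).seedTable (σ.L n) (σ.parse n s).1 (σ.parse n s).2))]
  simp only [Equiv.apply_symm_apply]

/-! ### The instance facts used by the reduction -/

/-- At a genuine instance `max Q 1 = Q`. [folklore] -/
theorem pp_Q_eq {n : ℕ} (h : σ.IsInst n) : (σ.pp n).Q = σ.Q (σ.m n) :=
  max_eq_left h.prime_Q.one_lt.le

/-- The facts about `⟨P, Q, g⟩` consumed by the reduction: `P ≠ 0`, `P ≤ 2^m`, `Q ≤ 2^m`, `ord g = Q`. [cite: NaorReingold2004, §3.2 (p. 242)] -/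
theorem inst_facts {n : ℕ} (h : σ.IsInst n) :
    (σ.pp n).P ≠ 0 ∧ (σ.pp n).P ≤ 2 ^ (σ.pp n).m ∧ (σ.pp n).Q ≤ 2 ^ (σ.pp n).m ∧
      orderOf ((σ.pp n).g : ZMod (σ.pp n).P) = (σ.pp n).Q := by
  have hQ := pp_Q_eq h
  refine ⟨h.prime_P.ne_zero, h.lt_two_pow.le, ?_, ?_⟩
  · rw [hQ]
    have h1 : σ.Q (σ.m n) ≤ σ.P (σ.m n) - 1 := Nat.le_of_dvd (by have := h.prime_P.two_le; omega) h.dvd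
    have h2 := h.lt_two_pow
    change σ.Q (σ.m n) ≤ 2 ^ σ.m n
    omega
  · rw [hQ]; exact h.orderOf_eq

/-! ### The group is large -/

/-- `allMatch` along a map of wires. [folklore] -/
theorem allMatch_map {α β : Type*} (f : α → β) (ws : List α) (c a : β → Bool) :
    allMatch (ws.map f) c a = allMatch ws (c ∘ f) (a ∘ f) := by
  induction ws with
  | nil => rfl
  | cons i ws ih => simp only [List.map_cons, allMatch, List.foldr_cons, Function.comp] at ih ⊢; rw [ih]

/-- Group elements below `2^m` are determined by their `m` low bits. [folklore] -/
theorem bits_injective (pp : Params) [NeZero pp.P] (hP : pp.P ≤ 2 ^ pp.m) : Function.Injective pp.bits := by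
  intro u v huv
  apply ZMod.val_injective
  apply Nat.eq_of_testBit_eq
  intro l
  by_cases hl : l < pp.m
  · exact congrFun huv ⟨l, hl⟩
  · have hlt : ∀ w : ZMod pp.P, w.val < 2 ^ l := fun w =>
      (ZMod.val_lt w).trans_le (hP.trans (Nat.pow_le_pow_right (by norm_num) (by omega)))
    rw [Nat.testBit_eq_false_of_lt (hlt _), Nat.testBit_eq_false_of_lt (hlt _)]

/-- **The identity test**: a `B₂`-circuit with `≤ m + 1` gates deciding "`z = 1`" from the bits of a
challenge `(A, B, z)`. [folklore] -/
theorem exists_idTest (pp : Params) [NeZero pp.P] (hP : pp.P ≤ 2 ^ pp.m) :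
    ∃ C : Circuit (Fin 3 × Fin pp.m), C.IsOver B2 ∧ C.size ≤ pp.m + 1 ∧
      ∀ t : pp.Chal, C.eval (pp.chalBus t) = decide (t 2 = 1) := by
  let ws : List (Fin 3 × Fin pp.m) := (List.finRange pp.m).map fun i => ((2 : Fin 3), i)
  let c : Fin 3 × Fin pp.m → Bool := fun w => (1 : ZMod pp.P).val.testBit w.2.val
  have h := CktSizeVia.allMatch pp.chalBus c ws
  have hlen : ws.length = pp.m := by simp [ws]
  rw [hlen] at h
  refine CktSizeVia.exists_circuit (h.congr fun t => ?_)
  funext u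
  simp only [ws]
  rw [allMatch_map, allMatch_finRange_eq_decide]
  have hiff : ((pp.chalBus t) ∘ fun i => ((2 : Fin 3), i)) = (c ∘ fun i => ((2 : Fin 3), i)) ↔ t 2 = 1 := by
    constructor
    · intro heq
      exact bits_injective pp hP (funext fun i => congrFun heq i)
    · intro ht
      funext i
      simp [Params.chalBus, ddhEncode, c, ht]
  by_cases ht : t 2 = 1
  · rw [decide_eq_true (hiff.2 ht), decide_eq_true ht]
  · rw [decide_eq_false (fun heq => ht (hiff.1 heq)), decide_eq_false ht]

/-- On Diffie–Hellman triples, `g^{ab} = 1` iff `a = 0` or `b = 0` (for `a, b < Q = ord g`, `Q` prime). [folklore] -/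
theorem gpow_mul_eq_one_iff (pp : Params) (hord : orderOf (pp.g : ZMod pp.P) = pp.Q) (hprime : pp.Q.Prime)
    (a b : Fin pp.Q) : pp.gpow (a.val * b.val) = 1 ↔ a.val = 0 ∨ b.val = 0 := by
  rw [Params.gpow, ← orderOf_dvd_iff_pow_eq_one, hord, hprime.dvd_mul]
  constructor
  · rintro (h | h)
    · exact Or.inl (Nat.eq_zero_of_dvd_of_lt h a.isLt)
    · exact Or.inr (Nat.eq_zero_of_dvd_of_lt h b.isLt)
  · rintro (h | h)
    · exact Or.inl (h ▸ dvd_zero _)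
    · exact Or.inr (h ▸ dvd_zero _)

/-- `#{(a, b) ∈ ℤ_Q² | a = 0 ∨ b = 0} + (Q-1)² = Q²`. [folklore] -/
theorem card_fst_zero_or_snd_zero {Q : ℕ} (hQ : 0 < Q) :
    #{ab : Fin Q × Fin Q | ab.1.val = 0 ∨ ab.2.val = 0} + (Q - 1) * (Q - 1) = Q * Q := by
  set z : Fin Q := ⟨0, hQ⟩ with hz
  have hiff : ∀ a : Fin Q, a.val = 0 ↔ a = z := fun a => by rw [hz, Fin.ext_iff]
  have h := Finset.card_filter_add_card_filter_not (s := (univ : Finset (Fin Q × Fin Q)))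
    (p := fun ab : Fin Q × Fin Q => ab.1.val = 0 ∨ ab.2.val = 0)
  rw [card_univ, Fintype.card_prod, Fintype.card_fin] at h
  have hc : #(univ.filter fun ab : Fin Q × Fin Q => ¬ (ab.1.val = 0 ∨ ab.2.val = 0)) = (Q - 1) * (Q - 1) := by
    have hset : (univ.filter fun ab : Fin Q × Fin Q => ¬ (ab.1.val = 0 ∨ ab.2.val = 0)) =
        (univ.erase z) ×ˢ (univ.erase z) := by
      ext ab
      simp [not_or, hiff]
    rw [hset, card_product, card_erase_of_mem (mem_univ _), card_univ, Fintype.card_fin]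
  omega

/-- `#{(a, b, c) ∈ ℤ_Q³ | c = 0} = Q · Q · 1`. [folklore] -/
theorem card_third_zero {Q : ℕ} (hQ : 0 < Q) :
    #{abc : Fin Q × Fin Q × Fin Q | abc.2.2.val = 0} = Q * Q * 1 := by
  set z : Fin Q := ⟨0, hQ⟩ with hz
  have hset : (univ.filter fun abc : Fin Q × Fin Q × Fin Q => abc.2.2.val = 0) =
      (univ : Finset (Fin Q)) ×ˢ ((univ : Finset (Fin Q)) ×ˢ ({z} : Finset (Fin Q))) := by
    ext abc
    simp only [mem_filter, mem_univ, true_and, mem_product, mem_singleton]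
    rw [hz, Fin.ext_iff]
  rw [hset, card_product, card_product, card_singleton, card_univ, Fintype.card_fin, mul_assoc]

/-- **Subexponential DDH-hardness forces a large group**: if `⟨P, Q, g⟩` is an instance (`P ≤ 2^m`,
`ord g = Q` prime) against which every `B₂`-circuit of size `≤ 2^{m^δ}` has advantage
`< 2^{-m^δ}`, and `m + 1 ≤ 2^{m^δ}`, then `2^{m^δ} < 2Q`: the `(m+1)`-gate test "`z = 1`" accepts a
Diffie–Hellman triple with probability `(2Q-1)/Q²` and a random one with probability `1/Q`.
[cite: NaorReingold2004, §3.2 (p. 242: "Q a (large) prime divisor of P-1")] -/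
theorem two_rpow_lt_two_mul_Q (pp : Params) [NeZero pp.P] (hP : pp.P ≤ 2 ^ pp.m)
    (hord : orderOf (pp.g : ZMod pp.P) = pp.Q) (hprime : pp.Q.Prime) {δ : ℝ}
    (hsize : ((pp.m + 1 : ℕ) : ℝ) ≤ (2 : ℝ) ^ ((pp.m : ℝ) ^ δ))
    (H : ∀ C : Circuit (Fin 3 × Fin pp.m), C.IsOver B2 → (C.size : ℝ) ≤ (2 : ℝ) ^ ((pp.m : ℝ) ^ δ) →
      ddhAdvantage pp.m pp.P pp.Q pp.g C < (2 : ℝ) ^ (-((pp.m : ℝ) ^ δ))) :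
    (2 : ℝ) ^ ((pp.m : ℝ) ^ δ) < 2 * pp.Q := by
  obtain ⟨C, hC, hs, hev⟩ := exists_idTest pp hP
  have hadv := H C hC ((Nat.cast_le.2 hs).trans hsize)
  have hQpos : 0 < pp.Q := hprime.pos
  have hQ2 : 2 ≤ pp.Q := hprime.two_le
  -- the acceptance counts of the identity test
  have hreal : ddhRealAccept pp.m pp.P pp.Q pp.g C + (pp.Q - 1) * (pp.Q - 1) = pp.Q * pp.Q := by
    rw [← card_fst_zero_or_snd_zero hQpos]
    unfold ddhRealAccept
    congr 2
    ext ab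
    simp only [mem_filter, mem_univ, true_and]
    rw [show ddhEncode pp.m pp.P ![(pp.g : ZMod pp.P) ^ (ab.1 : ℕ), (pp.g : ZMod pp.P) ^ (ab.2 : ℕ),
        (pp.g : ZMod pp.P) ^ ((ab.1 : ℕ) * (ab.2 : ℕ))] = pp.chalBus ![pp.gpow ab.1.val, pp.gpow ab.2.val,
        pp.gpow (ab.1.val * ab.2.val)] from rfl, hev]
    simp only [Matrix.cons_val_two, Matrix.tail_cons, Matrix.head_cons, decide_eq_true_eq]
    exact gpow_mul_eq_one_iff pp hord hprime ab.1 ab.2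
  have hrand : ddhRandAccept pp.m pp.P pp.Q pp.g C = pp.Q * pp.Q * 1 := by
    rw [← card_third_zero hQpos]
    unfold ddhRandAccept
    congr 1
    ext abc
    simp only [mem_filter, mem_univ, true_and]
    rw [show ddhEncode pp.m pp.P ![(pp.g : ZMod pp.P) ^ (abc.1 : ℕ), (pp.g : ZMod pp.P) ^ (abc.2.1 : ℕ),
        (pp.g : ZMod pp.P) ^ (abc.2.2 : ℕ)] = pp.chalBus ![pp.gpow abc.1.val, pp.gpow abc.2.1.val,
        pp.gpow abc.2.2.val] from rfl, hev]
    simp only [Matrix.cons_val_two, Matrix.tail_cons, Matrix.head_cons, decide_eq_true_eq]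
    rw [Params.gpow, ← orderOf_dvd_iff_pow_eq_one, hord]
    exact ⟨fun h => Nat.eq_zero_of_dvd_of_lt h abc.2.2.isLt, fun h => h ▸ dvd_zero _⟩
  -- the advantage is `(Q - 1)/Q² ≥ 1/(2Q)`
  have hQr : (2 : ℝ) ≤ pp.Q := by exact_mod_cast hQ2
  have hQpos' : (0 : ℝ) < pp.Q := by linarith
  have hrealR : (ddhRealAccept pp.m pp.P pp.Q pp.g C : ℝ) = 2 * pp.Q - 1 := by
    have h1 : ((ddhRealAccept pp.m pp.P pp.Q pp.g C + (pp.Q - 1) * (pp.Q - 1) : ℕ) : ℝ) = ((pp.Q * pp.Q : ℕ) : ℝ) := by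
      rw [hreal]
    push_cast [Nat.cast_sub (by omega : 1 ≤ pp.Q)] at h1
    nlinarith
  have hrandR : (ddhRandAccept pp.m pp.P pp.Q pp.g C : ℝ) = pp.Q * pp.Q := by
    rw [hrand]; push_cast; ring
  unfold ddhAdvantage at hadv
  rw [hrealR, hrandR] at hadv
  have hval : (2 * (pp.Q : ℝ) - 1) / (pp.Q : ℝ) ^ 2 - pp.Q * pp.Q / (pp.Q : ℝ) ^ 3 = (pp.Q - 1) / (pp.Q : ℝ) ^ 2 := by
    field_simp
    ring
  rw [hval, abs_of_nonneg (div_nonneg (by linarith) (by positivity))] at hadv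
  have hlow : 1 / (2 * (pp.Q : ℝ)) ≤ (pp.Q - 1) / (pp.Q : ℝ) ^ 2 := by
    rw [div_le_div_iff₀ (by positivity) (by positivity)]
    nlinarith
  have h2 : 1 / (2 * (pp.Q : ℝ)) < (2 : ℝ) ^ (-((pp.m : ℝ) ^ δ)) := hlow.trans_lt hadv
  rw [Real.rpow_neg (by norm_num), ← one_div] at h2
  have hpow : (0 : ℝ) < (2 : ℝ) ^ ((pp.m : ℝ) ^ δ) := by positivity
  rw [one_div_lt_one_div (by positivity) hpow] at h2
  exact h2

/-! ### The simulator's gate count is polynomial -/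

/-- `entryCost ≤ 47 (m + 2)⁴`. [folklore] -/
theorem entryCost_le (pp : Params) : pp.entryCost ≤ 47 * (pp.m + 2) ^ 4 := by
  have h1 : modAddCost pp.m = 9 * (pp.m + 2) ^ 2 := rfl
  have h2 : modMulCost pp.m ≤ 21 * (pp.m + 2) ^ 3 := by
    unfold modMulCost modMulStepCost
    rw [h1]
    nlinarith [Nat.zero_le pp.m, pow_two (pp.m + 2)]
  have h3 : powCost pp.m pp.m ≤ 46 * (pp.m + 2) ^ 4 := by
    unfold powCost powStepCost
    nlinarith [h2, Nat.zero_le pp.m]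
  unfold Params.entryCost
  nlinarith [h3]

end Seq

end NaorReingold

end Literature.Computability.Cryptography

end
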